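import Summits.HodgeConjecture.HodgeConjecture.Theorems.F0P3cStCharTSUpTrTubeOrbitSum       -- ★ (N4-C) p852425 (LH10-p01 g8): TORSOR `orbitSum_eq_sum_quotient`, `orbitSum_conj`; brings ★ (N4-A) `tubeJacobianSocket_cartan`, `sqrt_dgRadicand_conj`, ★ (N4-B)
import Summits.HodgeConjecture.HodgeConjecture.Theorems.F0P3cStCharTSUpTrTorusIntegrable   -- ★ (A0) p852383 (F0P2-p01 g23): `integrableOn_weighted_classFun_mul_classOrbitalIntegral`
import Summits.HodgeConjecture.HodgeConjecture.Theorems.F0P3cStCharTSWeylDiscrLocInt       -- ★ ROAD «HC-D» p852311 (F0P2-p01 g23): `locallyIntegrable_weylDiscr_inv` (`|D_G|^{-1∕2} ∈ L¹_loc`)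
import Literature.MeasureTheory.Group.FibreCountPullback                                  -- ★ Lusin–Souslin on injectivity patches: `measurableSet_image_inter_of_locallyInjOn`
import HarnessLib

/-!
# F0 · P3c · ROAD «UP-TR» brick (A0 v2) «SLOT INTEGRABILITY AT A CARTAN»: the two integrability binders of the «W-unfolded» tube formula ★ (N4)(c) for a torus weight
# dominated by `|D_G|^{-1∕2}` — orbit sums of measurable torus functions are measurable (Lusin–Souslin), and `|D_G|^{-1∕2} ∈ L¹_loc` (★ HC-D) pays both sides
# (Rogawski 1990 §12.5 pp. 182–183; Harish-Chandra 1970 Lemma 42, Thm. 15)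

Cell `pub/hodgecm-mathlib`, crux H413 = `stmt-HodgeConjecture-24833` (lane `--supports … --as helper`); seat F0P2-p01 (g24), heir of the (A0)∕(HC-D) lineage F0P2-p01 (g23);
ROAD «UP-TR» (holder ∕ dealer F0P3-p02 (g23); (A0 v2) re-dealt 19:13Z; consumer = (A1′) «UP-TR ASSEMBLY» LH10-p01 (g8), FILES D∕E).  THEOREMS ONLY; sorry-free; no definition ∕
instance ∕ notation ∕ named fact; ★-only imports; axioms TRIO.

WHY.  Under the locally-bounded reading of [Rogawski1990 §12.5 p. 183] (`UpSpecLB`, LEAD T14-26 (j1)) the assembly (A-3) of `∫_G f · α^G` runs ONE `(T_H, ψ)`-slot at a time through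
★ (N4)(c) `setIntegral_mul_orbitSum_cartanSet_eq` at the `G`-Cartan `T′ = Z_G(ψ γ₀)`, torus weight `K(t) = D_G(t)⁻¹ · τ · D_H · κ · α (ψ⁻¹ t)`.  That formula carries TWO integrability
binders — `hfκ : f · (Σ_{t ∈ T′, t ∼ y} K t) ∈ L¹(G_{T′}, ν)` and `hK : D(t) • (K t · Φ_G([t], f)) ∈ L¹(T′^{reg}, t_{T′})` — neither of which follows from `Integrable (f · α^G)` for a
sign-changing `K`.  Both DO follow from the single estimate `‖K t‖ ≤ B · D_G(t)⁻¹` on the part of `T′^{reg}` whose class meets `tsupport f` (what the LB antecedent gives: `‖τ‖, ‖κ‖ ≤ 1` ★ UpDom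
§1, `‖D_H·α‖ ≤ B` on a compact (A0-iv)) and Harish-Chandra's `|D_G|^{-1∕2} ∈ L¹_loc(G)` — IN HOUSE, ★ ROAD «HC-D» `locallyIntegrable_weylDiscr_inv`.  This file proves exactly that,
GENERIC in the torus weight `K` (no transfer-factor letter enters; FILE E instantiates `K := F ∘ e.symm`).  Frame and letters VERBATIM those of ★ (N4)(c) (`v` non-split, `T = Z(γ₀)` ANY Cartan
subgroup of `G = Gqs L v = U(Φ₃)(L⁺_v)`, `G_T = ⋃ₓ x T^{reg} x⁻¹`, `ν` Haar, `tT` THE Haar measure of `T` with inversion symmetry and mass one on `compactCore T`, `mQv` canonical, weight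
`√radicand(t) = √(∏_w |disc χ_t|_w (∏_w |det t|_w)⁻²) = D_G(t)²`; `dg = √√radicand = D_G` is ★ HC-D's letter):
* §1 `measurable_indicator_image_of_comp_eq` (generic): a function on the target of a continuous map `Φ`, locally injective on a Borel set `D` of a Polish space, whose pull-back along
  `Φ` agrees on `D` with a measurable function, is measurable on `Φ(D)` (Lusin–Souslin patchwise, ★ `FibreCountPullback`).
* §2 **`measurable_indicator_cartanSet_orbitSum`** — for `K : T → ℂ` measurable, the ORBIT SUM `y ↦ Σ_{t ∈ T, t ∼ y} K t` is measurable on `G_T` (its pull-back along the conjugation family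
  is `(Σ_{n̄ ∈ N(T)∕T} K(n t n⁻¹)) ∘ pr₂` by ★ TORSOR; the family is locally injective on the regular part, ★ `exists_isOpen_injOn_conjFamily`).
* §3 **`integrableOn_mul_orbitSum_cartanSet_of_le`** — (ii): for `f ∈ SchwartzBruhat G` and `‖K t‖ ≤ B · dg(t)⁻¹` on `{t ∈ T^{reg} | [t] meets tsupport f}`, `f · (orbit sum of K) ∈ L¹(G_T, ν)`:
  TORSOR gives `‖Σ_{t ∼ y} K t‖ ≤ [N(T):T] · |B| · dg(y)⁻¹` on `G_T ∩ tsupport f`, and `‖f‖_∞ · 𝟙_{tsupport f} · dg⁻¹ ∈ L¹(ν)` by ★ HC-D on the compact `tsupport f`.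
* §4 **`integrableOn_weighted_mul_classOrbitalIntegral_of_le`** — (iii): under the same bound, `√radicand • (K · classOrbitalIntegral mQv f ⟦·⟧) ∈ L¹(T^{reg}, tT)`: ★ (A0)
  `integrableOn_weighted_classFun_mul_classOrbitalIntegral` at the CLASS FUNCTION `dg⁻¹` and the test function `‖f‖` (socket ★ (N4-A) `tubeJacobianSocket_cartan`; `G_T`-integrability of
  `‖f‖ · dg⁻¹` = ★ HC-D again) makes `√radicand • (dg⁻¹ · Φ_G(‖f‖))` integrable on `T^{reg}`, and `|B|` times it dominates (`‖Φ_G([t], f)‖ ≤ Φ_G([t], ‖f‖)`; `Φ_G([t], f) = 0` when the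
  class of `t` misses `tsupport f`, ★ `orbitalIntegral_eq_zero_of_forall_notMem_tsupport`).
HONEST LABEL: count-neutral; UP-TR block consequents move only at the rider editions; organs 2 = 2; h413 registry untouched; HC_CM is proved only modulo the printed citations
until rung 0 closes.

## References
* [Rogawski1990] J. D. Rogawski, *Automorphic Representations of Unitary Groups in Three Variables*, Ann. of Math. Stud. 123 (1990), §12.5 pp. 182–183 (Weyl integration formula;
  Lemma 12.5.1, «`α ↦ α^G` is given by integration against a class function»), §4.9 p. 54 (`D_G`).
* [HarishChandra1970] Harish-Chandra (notes by G. van Dijk), *Harmonic analysis on reductive p-adic groups*, LNM 162 (1970), Part V §4 Lemma 42 (the conjugation map is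
  `|W|`-to-one and locally injective on the regular set); Part VII §1 Thm. 15 (`|D_G|^{-1∕2}` locally integrable).
* [Kechris1995] A. S. Kechris, *Classical Descriptive Set Theory*, GTM 156 (1995), Thm. 15.1 (Lusin–Souslin).
-/

set_option autoImplicit false
-- the mandated namespace has the single-problem summit's repeated segment (`HodgeConjecture.HodgeConjecture`)
set_option linter.dupNamespace false

noncomputable section

open MeasureTheory Measure Set Filter Topology Function NumberField IsDedekindDomain Matrix
open Literature.MeasureTheory.Group
open Literature.NumberTheory.Automorphic Literature.NumberTheory.Automorphic.UnitaryGroup Literature.NumberTheory.Rogawski1990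
open Literature.NumberTheory.GaloisRepresentations
open Summit.HodgeConjecture.HodgeConjecture.Cruxes.H413
open Summit.HodgeConjecture.HodgeConjecture.Cruxes.H413.F0P3cStCharTSWeylHypMeasure
open Summit.HodgeConjecture.HodgeConjecture.Cruxes.H413.F0P3cStCharTSWeylCartanRadial
open Summit.HodgeConjecture.HodgeConjecture.Cruxes.H413.F0P3cStCharTSUpTrTubeSocketAnyCartan
open Summit.HodgeConjecture.HodgeConjecture.Cruxes.H413.F0P3cStCharTSUpTrTubeAnyCartan
open Summit.HodgeConjecture.HodgeConjecture.Cruxes.H413.F0P3cStCharTSUpTrTubeOrbitSum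
open Summit.HodgeConjecture.HodgeConjecture.Cruxes.H413.F0P3cStCharTSUpTrTorusIntegrable
open Summit.HodgeConjecture.HodgeConjecture.Cruxes.H413.F0P3cStCharTSWeylDiscrLocInt
open scoped ENNReal NNReal MatrixGroups Pointwise

namespace Summit.HodgeConjecture.HodgeConjecture.Cruxes.H413.F0P3cStCharTSUpTrSlotIntegrable

/-! ## §1 Generic: a function whose pull-back along a locally injective continuous map is measurable is measurable on the image (Lusin–Souslin) -/

section Generic

variable {M X : Type*} [TopologicalSpace M] [PolishSpace M] [MeasurableSpace M] [BorelSpace M]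
  [TopologicalSpace X] [T2Space X] [MeasurableSpace X] [BorelSpace X]
  {β : Type*} [MeasurableSpace β] [Zero β]
  {Φ : M → X} {D : Set M}

/-- **Measurability on the image of a locally injective continuous map.**  `Φ : M → X` continuous (`M` Polish, `X` Hausdorff), locally injective on the Borel set `D`; if `κ : X → β`
pulls back along `Φ` to a measurable `g` on `D` (`κ (Φ z) = g z` for `z ∈ D`), then `𝟙_{Φ(D)} · κ` is measurable: for Borel `B`, `κ⁻¹ B ∩ Φ(D) = Φ(g⁻¹ B ∩ D)` is Borel by Lusin–Souslin on the
injectivity patches (★ `measurableSet_image_inter_of_locallyInjOn`). [cite: Kechris1995, Thm. 15.1] [cite: HarishChandra1970, Lemma 42] -/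
theorem measurable_indicator_image_of_comp_eq (hD : MeasurableSet D) (hΦ : Continuous Φ)
    (hinj : ∀ z ∈ D, ∃ U : Set M, IsOpen U ∧ z ∈ U ∧ InjOn Φ (U ∩ D))
    {κ : X → β} {g : M → β} (hg : Measurable g) (hκg : ∀ z ∈ D, κ (Φ z) = g z) :
    Measurable ((Φ '' D).indicator κ) := by
  have hImD : MeasurableSet (Φ '' D) := measurableSet_image_of_locallyInjOn hD hΦ hinj
  intro B hB
  -- `κ⁻¹ B ∩ Φ(D) = Φ (g⁻¹ B ∩ D)`
  have hkey : κ ⁻¹' B ∩ Φ '' D = Φ '' (g ⁻¹' B ∩ D) := by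
    ext y
    constructor
    · rintro ⟨hy, z, hz, rfl⟩
      exact ⟨z, ⟨by rw [mem_preimage, ← hκg z hz]; exact hy, hz⟩, rfl⟩
    · rintro ⟨z, ⟨hzB, hz⟩, rfl⟩
      exact ⟨by rw [mem_preimage, hκg z hz]; exact hzB, z, hz, rfl⟩
  rw [indicator_preimage, Set.ite, hkey]
  exact (measurableSet_image_inter_of_locallyInjOn hD hΦ hinj (hg hB)).union ((measurable_const hB).diff hImD)

end Generic

/-! ## §2 Orbit sums of measurable torus functions are measurable on `G_T` -/

section OrbitSum

variable (L : Type) [Field L] [NumberField L] [IsCMField L] (v : HeightOneSpectrum (𝓞 ↥(maximalRealSubfield L)))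

set_option maxHeartbeats 1600000 in
set_option synthInstance.maxHeartbeats 400000 in
-- instance-term unification on the CM local carrier (as ★ (N4))
/-- **ORBIT SUMS ARE MEASURABLE ON `G_T`.**  `T = Z(γ₀)` a Cartan subgroup (`γ₀` regular, `v` non-split), `K : T → ℂ` measurable (NOT conjugation invariant): the orbit sum
`y ↦ Σ_{t ∈ T, t ∼ y} K t`, extended by `0` off the `T`-regular set `G_T = ⋃ₓ x T^{reg} x⁻¹`, is Borel measurable on `G = U(Φ₃)(L⁺_v)`.  PROOF: along the conjugation family `Φ(xT, t) = x t x⁻¹`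
the orbit sum pulls back on the regular part `D₀` of `G⧸T × T` to `(Σ_{n̄ ∈ N(T)∕T} K(n t n⁻¹)) ∘ pr₂` (★ TORSOR `orbitSum_eq_sum_quotient`, ★ `orbitSum_conj`), a measurable function; `Φ` is
continuous and locally injective on `D₀` (★ `exists_isOpen_injOn_conjFamily`) and `G_T = Φ(D₀)`; §1. [cite: Rogawski1990, §12.5 p. 182] [cite: HarishChandra1970, Lemma 42] [cite: Kechris1995, Thm. 15.1] -/
theorem measurable_indicator_cartanSet_orbitSum
    (hns : ∀ w : PlacesOver L v, IsCMField.complexConj L • w.1 = w.1)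
    [MeasurableSpace (Gqs L v)] [BorelSpace (Gqs L v)] [LocallyCompactSpace (Gqs L v)] [SecondCountableTopology (Gqs L v)] [T2Space (Gqs L v)]
    {T : Subgroup (Gqs L v)} {γ₀ : Gqs L v} (hγ₀ : IsRegularElt (γ₀.val : GL (Fin 3) (UnitaryGroup.LocalRing L v)))
    (hT : T = Subgroup.centralizer ({γ₀} : Set (Gqs L v)))
    (K : ↥T → ℂ) (hK : Measurable K) :
    Measurable ({x | ∃ g t : Gqs L v, t ∈ T ∧ IsRegularElt (t.val : GL (Fin 3) (UnitaryGroup.LocalRing L v)) ∧ g * t * g⁻¹ = x}.indicator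
      fun y => ∑ᶠ t : ↥T, {t' : ↥T | IsConj ((t' : Gqs L v)) y}.indicator K t) := by
  classical
  have hTc := isClosed_cartan hT
  have hTa := mul_comm_cartan hγ₀ hT
  have hW0 := index_cartan_subgroupOf_normalizer_ne_zero hγ₀ hT hns
  obtain ⟨Φ, hΦ⟩ := exists_conjFamily T hTa
  letI : MeasurableSpace (Gqs L v ⧸ T) := borel _
  haveI : BorelSpace (Gqs L v ⧸ T) := ⟨rfl⟩
  haveI : PolishSpace ((Gqs L v ⧸ T) × ↥T) := polishSpace_quotient_prod_subgroup T hTc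
  have hΦc : Continuous Φ := (continuous_conjFamily_and_smul T Φ hΦ).1
  haveI : SecondCountableTopology ↥T := TopologicalSpace.Subtype.secondCountableTopology _
  haveI : SecondCountableTopology (Gqs L v ⧸ T) := (QuotientGroup.isQuotientMap_mk _).secondCountableTopology QuotientGroup.isOpenMap_coe
  haveI : BorelSpace ((Gqs L v ⧸ T) × ↥T) := Prod.borelSpace
  have hRm := measurableSet_setOf_isRegularElt L v hns
  have hD₀ : MeasurableSet {p : (Gqs L v ⧸ T) × ↥T | ((p.2 : ↥T) : Gqs L v) ∈ {g : Gqs L v | IsRegularElt (g.val : GL (Fin 3) (LocalRing L v))}} :=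
    hRm.preimage (continuous_subtype_val.measurable.comp measurable_snd)
  have hinj : ∀ z ∈ {p : (Gqs L v ⧸ T) × ↥T | ((p.2 : ↥T) : Gqs L v) ∈ {g : Gqs L v | IsRegularElt (g.val : GL (Fin 3) (LocalRing L v))}},
      ∃ U : Set ((Gqs L v ⧸ T) × ↥T), IsOpen U ∧ z ∈ U ∧
        InjOn Φ (U ∩ {p | ((p.2 : ↥T) : Gqs L v) ∈ {g : Gqs L v | IsRegularElt (g.val : GL (Fin 3) (LocalRing L v))}}) := fun z _ =>
    exists_isOpen_injOn_conjFamily T hTc hTa Φ hΦ {x : Gqs L v | IsRegularElt (x.val : GL (Fin 3) (LocalRing L v))}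
      (fun t ht => centralizer_eq_cartan_of_isRegularElt hγ₀ hT t ht) hW0 z
  -- the `N(T)∕T`-indexed torus sum `KW(t) = Σ_{n̄} K(n t n⁻¹)` (TORSOR's right side), a measurable function of `t`
  set N : Subgroup (Gqs L v) := Subgroup.normalizer (T : Set (Gqs L v)) with hN
  haveI : (T.subgroupOf N).FiniteIndex := ⟨hW0⟩
  haveI : Fintype (↥N ⧸ (T.subgroupOf N)) := Fintype.ofFinite _
  set KW : ↥T → ℂ := fun t => ∑ᶠ w : ↥N ⧸ (T.subgroupOf N),
    K ⟨((w.out : ↥N) : Gqs L v) * (t : Gqs L v) * (((w.out : ↥N)) : Gqs L v)⁻¹, (Subgroup.mem_normalizer_iff.1 (w.out).2 (t : Gqs L v)).1 t.2⟩ with hKW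
  have hKWm : Measurable KW := by
    have hKW' : KW = fun t : ↥T => ∑ w : ↥N ⧸ (T.subgroupOf N),
        K ⟨((w.out : ↥N) : Gqs L v) * (t : Gqs L v) * (((w.out : ↥N)) : Gqs L v)⁻¹, (Subgroup.mem_normalizer_iff.1 (w.out).2 (t : Gqs L v)).1 t.2⟩ :=
      funext fun t => finsum_eq_sum_of_fintype _
    rw [hKW']
    refine Finset.measurable_sum _ fun w _ => hK.comp ?_
    have hc : Continuous fun t : ↥T => ((w.out : ↥N) : Gqs L v) * (t : Gqs L v) * (((w.out : ↥N)) : Gqs L v)⁻¹ :=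
      (continuous_const.mul continuous_subtype_val).mul continuous_const
    exact (hc.subtype_mk _).measurable
  -- the orbit sum pulls back to `KW ∘ pr₂` on the regular part
  have hid : ∀ z ∈ {p : (Gqs L v ⧸ T) × ↥T | ((p.2 : ↥T) : Gqs L v) ∈ {g : Gqs L v | IsRegularElt (g.val : GL (Fin 3) (LocalRing L v))}},
      (fun y => ∑ᶠ t : ↥T, {t' : ↥T | IsConj ((t' : Gqs L v)) y}.indicator K t) (Φ z) = (KW ∘ Prod.snd) z := by
    rintro ⟨q, t⟩ ht
    obtain ⟨x, rfl⟩ := QuotientGroup.mk_surjective q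
    simp only [Function.comp_apply, hKW]
    rw [hΦ x t, orbitSum_conj L v T K x (t : Gqs L v), orbitSum_eq_sum_quotient L v hγ₀ hT K t ht]
  rw [← image_conjFamily_regular_eq Φ hΦ]
  exact measurable_indicator_image_of_comp_eq hD₀ hΦc hinj (hKWm.comp measurable_snd) hid

/-! ## §3 (ii) The `G`-side binder: `f · (orbit sum of K)` is integrable on `G_T` when `‖K‖ ≤ B · D_G⁻¹` and `f` is a test function -/

/-- `D_G = √√radicand` is a class function on `U(Φ₃)(L⁺_v)` (★ (N4-A) `sqrt_dgRadicand_conj`). [cite: Rogawski1990, §4.9 p. 54; §12.5 p. 182] -/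
theorem sqrt_sqrt_dgRadicand_conj (g h : Gqs L v) :
    (((NNReal.sqrt (NNReal.sqrt ((∏ w : PlacesOver L v, IsNonarchimedeanLocalField.normAbs (w.1.adicCompletion L) ((((h * g * h⁻¹).val : GL (Fin 3) (UnitaryGroup.LocalRing L v)).val.charpoly.discr) w)) * ((∏ w : PlacesOver L v, IsNonarchimedeanLocalField.normAbs (w.1.adicCompletion L) ((((h * g * h⁻¹).val : GL (Fin 3) (UnitaryGroup.LocalRing L v)).val.det) w)) ^ 2)⁻¹))) : ℝ≥0) : ℝ) =
      (((NNReal.sqrt (NNReal.sqrt ((∏ w : PlacesOver L v, IsNonarchimedeanLocalField.normAbs (w.1.adicCompletion L) (((g.val : GL (Fin 3) (UnitaryGroup.LocalRing L v)).val.charpoly.discr) w)) * ((∏ w : PlacesOver L v, IsNonarchimedeanLocalField.normAbs (w.1.adicCompletion L) (((g.val : GL (Fin 3) (UnitaryGroup.LocalRing L v)).val.det) w)) ^ 2)⁻¹))) : ℝ≥0) : ℝ) := by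
  rw [sqrt_dgRadicand_conj L v g h]

set_option maxHeartbeats 1600000 in
set_option synthInstance.maxHeartbeats 400000 in
-- instance-term unification on the CM local carrier (as ★ (N4))
/-- **(A0 v2)(ii) THE `G`-SIDE INTEGRABILITY BINDER OF ★ (N4)(c).**  `T = Z(γ₀)` any Cartan subgroup of `G = U(Φ₃)(L⁺_v)` (`v` non-split), `ν` a Haar measure, `f ∈ SchwartzBruhat G`
(locally constant, compact support), `K : T → ℂ` measurable with **`‖K t‖ ≤ B · D_G(t)⁻¹`** for every regular `t ∈ T` whose class meets `tsupport f` (`D_G = √√radicand`, ★ HC-D's letter).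
THEN `y ↦ f(y) · Σ_{t ∈ T, t ∼ y} K t` is `ν`-integrable on `G_T = ⋃ₓ x T^{reg} x⁻¹`.  PROOF: for `y = x t₀ x⁻¹ ∈ G_T ∩ tsupport f` the orbit sum is `Σ_{n̄ ∈ N(T)∕T} K(n t₀ n⁻¹)` (★ TORSOR),
each term of norm `≤ B · D_G(y)⁻¹` (`D_G` is a class function), so `‖f(y) · Σ‖ ≤ ‖f‖_∞ · [N(T):T] · |B| · 𝟙_{tsupport f}(y) · D_G(y)⁻¹`, which is `ν`-integrable because
`D_G⁻¹ = |D|^{-1∕2} ∈ L¹_loc(G)` (★ ROAD «HC-D» `locallyIntegrable_weylDiscr_inv`, Harish-Chandra's Thm. 15 in house) and `tsupport f` is compact; measurability by §2.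
[cite: Rogawski1990, §12.5 pp. 182–183] [cite: HarishChandra1970, Part V §4 Lemma 42; Part VII §1 Thm. 15] -/
theorem integrableOn_mul_orbitSum_cartanSet_of_le
    (hns : ∀ w : PlacesOver L v, IsCMField.complexConj L • w.1 = w.1)
    [MeasurableSpace (Gqs L v)] [BorelSpace (Gqs L v)] [LocallyCompactSpace (Gqs L v)] [SecondCountableTopology (Gqs L v)] [T2Space (Gqs L v)]
    (ν : Measure (Gqs L v)) [ν.IsHaarMeasure]
    {T : Subgroup (Gqs L v)} {γ₀ : Gqs L v} (hγ₀ : IsRegularElt (γ₀.val : GL (Fin 3) (UnitaryGroup.LocalRing L v)))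
    (hT : T = Subgroup.centralizer ({γ₀} : Set (Gqs L v)))
    (f : Gqs L v → ℂ) (hf : f ∈ SchwartzBruhat (Gqs L v))
    (K : ↥T → ℂ) (hK : Measurable K) (B : ℝ)
    (hKB : ∀ t : ↥T, IsRegularElt (((t : Gqs L v)).val : GL (Fin 3) (UnitaryGroup.LocalRing L v)) → (∃ x : Gqs L v, x * (t : Gqs L v) * x⁻¹ ∈ tsupport f) →
        ‖K t‖ ≤ B * ((((NNReal.sqrt (NNReal.sqrt ((∏ w : PlacesOver L v, IsNonarchimedeanLocalField.normAbs (w.1.adicCompletion L) ((((t : Gqs L v).val : GL (Fin 3) (UnitaryGroup.LocalRing L v)).val.charpoly.discr) w)) * ((∏ w : PlacesOver L v, IsNonarchimedeanLocalField.normAbs (w.1.adicCompletion L) ((((t : Gqs L v).val : GL (Fin 3) (UnitaryGroup.LocalRing L v)).val.det) w)) ^ 2)⁻¹))) : ℝ≥0) : ℝ))⁻¹) :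
    IntegrableOn (fun y => f y * ∑ᶠ t : ↥T, {t' : ↥T | IsConj ((t' : Gqs L v)) y}.indicator K t)
      {x | ∃ g t : Gqs L v, t ∈ T ∧ IsRegularElt (t.val : GL (Fin 3) (UnitaryGroup.LocalRing L v)) ∧ g * t * g⁻¹ = x} ν := by
  classical
  set GT : Set (Gqs L v) := {x | ∃ g t : Gqs L v, t ∈ T ∧ IsRegularElt (t.val : GL (Fin 3) (UnitaryGroup.LocalRing L v)) ∧ g * t * g⁻¹ = x} with hGT
  set κ : Gqs L v → ℂ := fun y => ∑ᶠ t : ↥T, {t' : ↥T | IsConj ((t' : Gqs L v)) y}.indicator K t with hκ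
  set dg : Gqs L v → ℝ := fun g => (((NNReal.sqrt (NNReal.sqrt ((∏ w : PlacesOver L v, IsNonarchimedeanLocalField.normAbs (w.1.adicCompletion L) (((g.val : GL (Fin 3) (UnitaryGroup.LocalRing L v)).val.charpoly.discr) w)) * ((∏ w : PlacesOver L v, IsNonarchimedeanLocalField.normAbs (w.1.adicCompletion L) (((g.val : GL (Fin 3) (UnitaryGroup.LocalRing L v)).val.det) w)) ^ 2)⁻¹))) : ℝ≥0) : ℝ) with hdg
  have hdg0 : ∀ g, 0 ≤ dg g := fun g => NNReal.coe_nonneg _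
  have hdgconj : ∀ g h : Gqs L v, dg (h * g * h⁻¹) = dg g := fun g h => sqrt_sqrt_dgRadicand_conj L v g h
  have hTa := mul_comm_cartan hγ₀ hT
  have hW0 := index_cartan_subgroupOf_normalizer_ne_zero hγ₀ hT hns
  obtain ⟨Φ, hΦ⟩ := exists_conjFamily T hTa
  letI : MeasurableSpace (Gqs L v ⧸ T) := borel _
  haveI : BorelSpace (Gqs L v ⧸ T) := ⟨rfl⟩
  have hGTm : MeasurableSet GT := measurableSet_cartanSet hγ₀ hT Φ hΦ hns
  set N : Subgroup (Gqs L v) := Subgroup.normalizer (T : Set (Gqs L v)) with hN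
  haveI : (T.subgroupOf N).FiniteIndex := ⟨hW0⟩
  haveI : Fintype (↥N ⧸ (T.subgroupOf N)) := Fintype.ofFinite _
  have hfc : Continuous f := hf.1.continuous
  have hfK : HasCompactSupport f := hf.2
  obtain ⟨Cf, hCf⟩ := hfK.exists_bound_of_continuous hfc
  have hCf0 : 0 ≤ Cf := (norm_nonneg _).trans (hCf 1)
  set C : ℝ := Cf * (((T.subgroupOf N).index : ℝ) * |B|) with hC
  set g₀ : Gqs L v → ℝ := (tsupport f).indicator fun y => C * (dg y)⁻¹ with hg₀
  have hg₀i : Integrable g₀ ν := by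
    have hloc : LocallyIntegrable (fun y => (dg y)⁻¹) ν := locallyIntegrable_weylDiscr_inv L v hns ν
    have hint : IntegrableOn (fun y => (dg y)⁻¹) (tsupport f) ν := hloc.integrableOn_isCompact hfK.isCompact
    exact IntegrableOn.integrable_indicator (hint.const_mul C) (isClosed_tsupport f).measurableSet
  have hmeas : AEStronglyMeasurable (fun y => f y * κ y) (ν.restrict GT) := by
    have h1 : Measurable (GT.indicator κ) := measurable_indicator_cartanSet_orbitSum L v hns hγ₀ hT K hK
    have h2 : (fun y => f y * GT.indicator κ y) =ᵐ[ν.restrict GT] fun y => f y * κ y := by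
      filter_upwards [ae_restrict_mem hGTm] with y hy
      rw [indicator_of_mem hy]
    exact (hfc.measurable.mul h1).aestronglyMeasurable.congr h2
  have hbound : ∀ y ∈ GT, ‖f y * κ y‖ ≤ g₀ y := by
    rintro y ⟨x, t₀, ht₀T, ht₀, rfl⟩
    by_cases hy : x * t₀ * x⁻¹ ∈ tsupport f
    · rw [hg₀, indicator_of_mem hy]
      -- the orbit sum at `y = x t₀ x⁻¹` is the TORSOR sum at `t₀`
      have hκy : κ (x * t₀ * x⁻¹) = ∑ w : ↥N ⧸ (T.subgroupOf N),
          K ⟨((w.out : ↥N) : Gqs L v) * t₀ * (((w.out : ↥N)) : Gqs L v)⁻¹, (Subgroup.mem_normalizer_iff.1 (w.out).2 t₀).1 ht₀T⟩ := by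
        simp only [hκ]
        rw [orbitSum_conj L v T K x t₀, orbitSum_eq_sum_quotient L v hγ₀ hT K ⟨t₀, ht₀T⟩ ht₀, finsum_eq_sum_of_fintype]
      -- each term is bounded by `|B| · D_G(y)⁻¹`
      have hterm : ∀ w : ↥N ⧸ (T.subgroupOf N),
          ‖K ⟨((w.out : ↥N) : Gqs L v) * t₀ * (((w.out : ↥N)) : Gqs L v)⁻¹, (Subgroup.mem_normalizer_iff.1 (w.out).2 t₀).1 ht₀T⟩‖ ≤ |B| * (dg (x * t₀ * x⁻¹))⁻¹ := by
        intro w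
        set n : Gqs L v := ((w.out : ↥N) : Gqs L v) with hn
        have hreg : IsRegularElt ((((⟨n * t₀ * n⁻¹, (Subgroup.mem_normalizer_iff.1 (w.out).2 t₀).1 ht₀T⟩ : ↥T) : Gqs L v)).val : GL (Fin 3) (UnitaryGroup.LocalRing L v)) :=
          (isRegularElt_conj_val_iff L v n t₀).2 ht₀
        have hmeet : ∃ x' : Gqs L v, x' * (((⟨n * t₀ * n⁻¹, (Subgroup.mem_normalizer_iff.1 (w.out).2 t₀).1 ht₀T⟩ : ↥T) : Gqs L v)) * x'⁻¹ ∈ tsupport f := by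
          refine ⟨x * n⁻¹, ?_⟩
          have : x * n⁻¹ * (n * t₀ * n⁻¹) * (x * n⁻¹)⁻¹ = x * t₀ * x⁻¹ := by group
          rw [Subgroup.coe_mk, this]; exact hy
        have h : ‖K ⟨n * t₀ * n⁻¹, (Subgroup.mem_normalizer_iff.1 (w.out).2 t₀).1 ht₀T⟩‖ ≤ B * (dg (n * t₀ * n⁻¹))⁻¹ := hKB _ hreg hmeet
        have hdgeq : dg (n * t₀ * n⁻¹) = dg (x * t₀ * x⁻¹) := by rw [hdgconj, hdgconj]
        rw [hdgeq] at h
        exact h.trans (mul_le_mul_of_nonneg_right (le_abs_self B) (inv_nonneg.2 (hdg0 _)))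
      have hκn : ‖κ (x * t₀ * x⁻¹)‖ ≤ ((T.subgroupOf N).index : ℝ) * |B| * (dg (x * t₀ * x⁻¹))⁻¹ := by
        rw [hκy]
        refine (norm_sum_le _ _).trans ((Finset.sum_le_sum fun w _ => hterm w).trans (le_of_eq ?_))
        rw [Finset.sum_const, Finset.card_univ, ← Nat.card_eq_fintype_card, ← Subgroup.index_eq_card, nsmul_eq_mul]
        ring
      rw [norm_mul, hC]
      calc ‖f (x * t₀ * x⁻¹)‖ * ‖κ (x * t₀ * x⁻¹)‖
          ≤ Cf * (((T.subgroupOf N).index : ℝ) * |B| * (dg (x * t₀ * x⁻¹))⁻¹) :=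
            mul_le_mul (hCf _) hκn (norm_nonneg _) hCf0
        _ = Cf * (((T.subgroupOf N).index : ℝ) * |B|) * (dg (x * t₀ * x⁻¹))⁻¹ := by ring
    · rw [hg₀, indicator_of_notMem hy, image_eq_zero_of_notMem_tsupport hy, zero_mul, norm_zero]
  exact Integrable.mono' hg₀i.integrableOn hmeas ((ae_restrict_iff' hGTm).2 (Eventually.of_forall hbound))

/-! ## §4 (iii) The torus-side binder: `√radicand • (K · Φ_G(f))` is integrable on `T^{reg}` when `‖K‖ ≤ B · D_G⁻¹` and `f` is a test function -/

/-- `‖O_γ^m(f)‖ ≤ ‖O_γ^m(‖f‖)‖` — the orbital integral of `f` is dominated by the orbital integral of the REAL test function `‖f‖` (viewed in `ℂ`): `‖∫ f(yγy⁻¹)‖ ≤ ∫ ‖f(yγy⁻¹)‖`, and the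
latter is the (real, non-negative) value of `O_γ^m(‖f‖)`. [cite: Rogawski1990, §4.9 p. 54] -/
theorem norm_orbitalIntegral_le_norm_orbitalIntegral_norm {G : Type*} [Group G] (γ : G) [MeasurableSpace (G ⧸ Subgroup.centralizer ({γ} : Set G))]
    (m : Measure (G ⧸ Subgroup.centralizer ({γ} : Set G))) (f : G → ℂ) :
    ‖orbitalIntegral γ f m‖ ≤ ‖orbitalIntegral γ (fun x => ((‖f x‖ : ℝ) : ℂ)) m‖ := by
  rw [orbitalIntegral_eq_integral_descConj γ m f, orbitalIntegral_eq_integral_descConj γ m]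
  have hpt : ∀ y : G ⧸ Subgroup.centralizer ({γ} : Set G),
      descConj γ (Subgroup.centralizer ({γ} : Set G)) (fun _ hg => Subgroup.mem_centralizer_singleton_iff.1 hg) (fun x => ((‖f x‖ : ℝ) : ℂ)) y =
        ((‖descConj γ (Subgroup.centralizer ({γ} : Set G)) (fun _ hg => Subgroup.mem_centralizer_singleton_iff.1 hg) f y‖ : ℝ) : ℂ) := by
    intro y
    induction y using QuotientGroup.induction_on with
    | H g => rfl
  simp_rw [hpt]
  have key : (∫ y, ((‖descConj γ (Subgroup.centralizer ({γ} : Set G)) (fun _ hg => Subgroup.mem_centralizer_singleton_iff.1 hg) f y‖ : ℝ) : ℂ) ∂m) =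
      ((∫ y, ‖descConj γ (Subgroup.centralizer ({γ} : Set G)) (fun _ hg => Subgroup.mem_centralizer_singleton_iff.1 hg) f y‖ ∂m : ℝ) : ℂ) :=
    integral_ofReal
  rw [key, Complex.norm_real, Real.norm_eq_abs]
  exact (norm_integral_le_integral_norm _).trans (le_abs_self _)

/-- `O_{[t]}(f) = 0` when the class of `t` misses `tsupport f` (★ `orbitalIntegral_eq_zero_of_forall_notMem_tsupport` at the representative `out ⟦t⟧ ∼ t`). [cite: Rogawski1990, §4.9 p. 54] -/
theorem classOrbitalIntegral_mk_eq_zero_of_forall_notMem_tsupport {G : Type*} [Group G] [TopologicalSpace G]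
    [∀ γ : G, MeasurableSpace (G ⧸ Subgroup.centralizer ({γ} : Set G))] (m : OrbitalMeasureFamily G) {f : G → ℂ} (t : G)
    (h : ∀ x : G, x * t * x⁻¹ ∉ tsupport f) : classOrbitalIntegral m f (ConjClasses.mk t) = 0 := by
  rw [classOrbitalIntegral_eq]
  refine orbitalIntegral_eq_zero_of_forall_notMem_tsupport _ _ fun g hg => ?_
  obtain ⟨c, hc⟩ := isConj_iff.1 (ConjClasses.mk_eq_mk_iff_isConj.1 (Quotient.out_eq (ConjClasses.mk t)))
  -- `out ⟦t⟧ = c⁻¹ t c`… precisely `c * out ⟦t⟧ * c⁻¹ = t`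
  refine h (g * c⁻¹) ?_
  have : g * c⁻¹ * t * (g * c⁻¹)⁻¹ = g * (Quotient.out (ConjClasses.mk t) : G) * g⁻¹ := by
    conv_lhs => rw [← hc]
    group
  rw [this]; exact hg

set_option maxHeartbeats 1600000 in
set_option synthInstance.maxHeartbeats 400000 in
-- instance-term unification on the CM local carrier (as ★ (N4), ★ (A0))
/-- **(A0 v2)(iii) THE TORUS-SIDE INTEGRABILITY BINDER OF ★ (N4)(c).**  Same frame as (ii), plus the CANONICAL orbital measures `mQv` and THE Haar measure `tT` of `T = Z(γ₀)` with inversion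
symmetry and mass one on `compactCore T`: if `‖K t‖ ≤ B · D_G(t)⁻¹` for every regular `t ∈ T` whose class meets `tsupport f`, then
**`t ↦ √radicand(t) • (K t · classOrbitalIntegral mQv f ⟦t⟧)` is `tT`-integrable on `T^{reg}`** (`√radicand = D_G²`).  PROOF: ★ (A0) `integrableOn_weighted_classFun_mul_classOrbitalIntegral`
(socket ★ (N4-A) `tubeJacobianSocket_cartan`) at the CLASS FUNCTION `D_G⁻¹` and the test function `‖f‖` — whose product is `ν`-integrable on `G_T` by ★ HC-D `locallyIntegrable_weylDiscr_inv`
(`‖f‖ ≤ ‖f‖_∞ 𝟙_{tsupport f}`, compact) — gives `√radicand • (D_G⁻¹ · Φ_G(‖f‖)) ∈ L¹(T^{reg}, tT)`; `|B|` times its norm dominates, since `‖Φ_G([t], f)‖ ≤ ‖Φ_G([t], ‖f‖)‖` and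
`Φ_G([t], f) = 0` when the class of `t` misses `tsupport f`; a.e.-measurability from the same ★ (A0) at `α ≡ 1` (`K •` a measurable scalar).
[cite: Rogawski1990, §12.5 pp. 182–183; §4.3 (4.3.1) p. 43] [cite: HarishChandra1970, Part V §4 Lemma 42; Part VII §1 Thm. 15] -/
theorem integrableOn_weighted_mul_classOrbitalIntegral_of_le
    (hns : ∀ w : PlacesOver L v, IsCMField.complexConj L • w.1 = w.1)
    [MeasurableSpace (Gqs L v)] [BorelSpace (Gqs L v)] [LocallyCompactSpace (Gqs L v)] [SecondCountableTopology (Gqs L v)] [T2Space (Gqs L v)]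
    [∀ γ' : Gqs L v, MeasurableSpace (Gqs L v ⧸ Subgroup.centralizer ({γ'} : Set (Gqs L v)))]
    [∀ γ' : Gqs L v, BorelSpace (Gqs L v ⧸ Subgroup.centralizer ({γ'} : Set (Gqs L v)))]
    (ν : Measure (Gqs L v)) [ν.IsHaarMeasure] [ν.IsMulRightInvariant]
    {mQv : OrbitalMeasureFamily (Gqs L v)} (hcanQ : mQv.IsCanonical (fun γ' => IsRegularElt (γ'.val : GL (Fin 3) (UnitaryGroup.LocalRing L v))) ν)
    {T : Subgroup (Gqs L v)} {γ₀ : Gqs L v} (hγ₀ : IsRegularElt (γ₀.val : GL (Fin 3) (UnitaryGroup.LocalRing L v)))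
    (hT : T = Subgroup.centralizer ({γ₀} : Set (Gqs L v)))
    [MeasurableSpace (Gqs L v ⧸ T)] [BorelSpace (Gqs L v ⧸ T)]
    (tT : Measure ↥T) [tT.IsHaarMeasure] [tT.IsInvInvariant] (htT : tT (compactCore ↥T) = 1)
    (f : Gqs L v → ℂ) (hf : f ∈ SchwartzBruhat (Gqs L v))
    (K : ↥T → ℂ) (hK : Measurable K) (B : ℝ)
    (hKB : ∀ t : ↥T, IsRegularElt (((t : Gqs L v)).val : GL (Fin 3) (UnitaryGroup.LocalRing L v)) → (∃ x : Gqs L v, x * (t : Gqs L v) * x⁻¹ ∈ tsupport f) →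
        ‖K t‖ ≤ B * ((((NNReal.sqrt (NNReal.sqrt ((∏ w : PlacesOver L v, IsNonarchimedeanLocalField.normAbs (w.1.adicCompletion L) ((((t : Gqs L v).val : GL (Fin 3) (UnitaryGroup.LocalRing L v)).val.charpoly.discr) w)) * ((∏ w : PlacesOver L v, IsNonarchimedeanLocalField.normAbs (w.1.adicCompletion L) ((((t : Gqs L v).val : GL (Fin 3) (UnitaryGroup.LocalRing L v)).val.det) w)) ^ 2)⁻¹))) : ℝ≥0) : ℝ))⁻¹) :
    IntegrableOn (fun t : ↥T =>
        ((NNReal.sqrt ((∏ w : PlacesOver L v, IsNonarchimedeanLocalField.normAbs (w.1.adicCompletion L) ((((t : Gqs L v).val : GL (Fin 3) (UnitaryGroup.LocalRing L v)).val.charpoly.discr) w)) * ((∏ w : PlacesOver L v, IsNonarchimedeanLocalField.normAbs (w.1.adicCompletion L) ((((t : Gqs L v).val : GL (Fin 3) (UnitaryGroup.LocalRing L v)).val.det) w)) ^ 2)⁻¹) : ℝ≥0) : ℝ) •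
          (K t * classOrbitalIntegral mQv f (ConjClasses.mk (t : Gqs L v))))
      {t : ↥T | IsRegularElt (((t : Gqs L v)).val : GL (Fin 3) (UnitaryGroup.LocalRing L v))} tT := by
  classical
  set GT : Set (Gqs L v) := {x | ∃ g t : Gqs L v, t ∈ T ∧ IsRegularElt (t.val : GL (Fin 3) (UnitaryGroup.LocalRing L v)) ∧ g * t * g⁻¹ = x} with hGT
  set Treg : Set ↥T := {t : ↥T | IsRegularElt (((t : Gqs L v)).val : GL (Fin 3) (UnitaryGroup.LocalRing L v))} with hTreg
  set D : ↥T → ℝ≥0 := fun t => NNReal.sqrt ((∏ w : PlacesOver L v, IsNonarchimedeanLocalField.normAbs (w.1.adicCompletion L) ((((t : Gqs L v).val : GL (Fin 3) (UnitaryGroup.LocalRing L v)).val.charpoly.discr) w)) * ((∏ w : PlacesOver L v, IsNonarchimedeanLocalField.normAbs (w.1.adicCompletion L) ((((t : Gqs L v).val : GL (Fin 3) (UnitaryGroup.LocalRing L v)).val.det) w)) ^ 2)⁻¹) with hDdef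
  set O : ↥T → ℂ := fun t => classOrbitalIntegral mQv f (ConjClasses.mk (t : Gqs L v)) with hOdef
  set dg : Gqs L v → ℝ := fun g => (((NNReal.sqrt (NNReal.sqrt ((∏ w : PlacesOver L v, IsNonarchimedeanLocalField.normAbs (w.1.adicCompletion L) (((g.val : GL (Fin 3) (UnitaryGroup.LocalRing L v)).val.charpoly.discr) w)) * ((∏ w : PlacesOver L v, IsNonarchimedeanLocalField.normAbs (w.1.adicCompletion L) (((g.val : GL (Fin 3) (UnitaryGroup.LocalRing L v)).val.det) w)) ^ 2)⁻¹))) : ℝ≥0) : ℝ) with hdg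
  have hdg0 : ∀ g, 0 ≤ dg g := fun g => NNReal.coe_nonneg _
  have hdgconj : ∀ g h : Gqs L v, dg (h * g * h⁻¹) = dg g := fun g h => sqrt_sqrt_dgRadicand_conj L v g h
  have hdgc : Continuous dg := F0P3cStCharTSDGField.continuous_dgFormula L v
  obtain ⟨w₀⟩ := (inferInstance : Nonempty (PlacesOver L v))
  have hTregm : MeasurableSet Treg :=
    ((isOpen_setOf_isRegularElt_cmDatum_local (L := L) (H := qsForm L) (v := v) w₀ (hns w₀)).preimage continuous_subtype_val).measurableSet
  have hTa := mul_comm_cartan hγ₀ hT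
  obtain ⟨Φ, hΦ⟩ := exists_conjFamily T hTa
  have hJac := tubeJacobianSocket_cartan L v hns ν hγ₀ hT tT htT Φ hΦ
  have hDm : Measurable D := measurable_sqrt_dgRadicand_subtype L v T
  have hfc : Continuous f := hf.1.continuous
  have hfK : HasCompactSupport f := hf.2
  obtain ⟨Cf, hCf⟩ := hfK.exists_bound_of_continuous hfc
  set α : Gqs L v → ℂ := fun y => ((dg y : ℝ) : ℂ)⁻¹ with hα
  set φ : Gqs L v → ℂ := fun y => ((‖f y‖ : ℝ) : ℂ) with hφ
  have hφm : Measurable φ := (Complex.continuous_ofReal.comp hfc.norm).measurable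
  have hαm : Measurable α := (Complex.continuous_ofReal.comp hdgc).measurable.inv
  have hαcl : ∀ x t : Gqs L v, IsRegularElt (t.val : GL (Fin 3) (UnitaryGroup.LocalRing L v)) → α (x * t * x⁻¹) = α t := fun x t _ => by
    simp only [hα, hdgconj]
  have hαn : ∀ y, ‖α y‖ = (dg y)⁻¹ := fun y => by
    simp only [hα, norm_inv, Complex.norm_real, Real.norm_eq_abs, abs_of_nonneg (hdg0 y)]
  -- `φ · α` is `ν`-integrable (on `G`, hence on `G_T`): dominated by `‖f‖_∞ · 𝟙_{tsupport f} · D_G⁻¹` — ★ HC-D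
  have hφα : IntegrableOn (fun y => φ y * α y) GT ν := by
    have hloc : LocallyIntegrable (fun y => (dg y)⁻¹) ν := locallyIntegrable_weylDiscr_inv L v hns ν
    have hint : IntegrableOn (fun y => (dg y)⁻¹) (tsupport f) ν := hloc.integrableOn_isCompact hfK.isCompact
    have hg₀ : Integrable ((tsupport f).indicator fun y => Cf * (dg y)⁻¹) ν :=
      IntegrableOn.integrable_indicator (hint.const_mul Cf) (isClosed_tsupport f).measurableSet
    refine (Integrable.mono' hg₀ (hφm.mul hαm).aestronglyMeasurable (Eventually.of_forall fun y => ?_)).integrableOn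
    change ‖φ y * α y‖ ≤ _
    by_cases hy : y ∈ tsupport f
    · rw [indicator_of_mem hy, norm_mul, hαn, hφ, Complex.norm_real, norm_norm]
      exact mul_le_mul_of_nonneg_right (hCf y) (inv_nonneg.2 (hdg0 y))
    · rw [indicator_of_notMem hy, norm_mul]
      have hfy : f y = 0 := image_eq_zero_of_notMem_tsupport hy
      simp only [hφ, hfy, norm_zero, Complex.ofReal_zero, zero_mul, le_refl]
  have hA : IntegrableOn (fun t : ↥T => (D t : ℝ) • (α (t : Gqs L v) * classOrbitalIntegral mQv φ (ConjClasses.mk (t : Gqs L v)))) Treg tT :=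
    integrableOn_weighted_classFun_mul_classOrbitalIntegral hγ₀ hT Φ hΦ hns ν hcanQ tT htT D hDm hJac φ α hφm hαcl hφα
  have hA1 : IntegrableOn (fun t : ↥T => (D t : ℝ) • ((fun _ => (1 : ℂ)) (t : Gqs L v) * O t)) Treg tT := by
    refine integrableOn_weighted_classFun_mul_classOrbitalIntegral hγ₀ hT Φ hΦ hns ν hcanQ tT htT D hDm hJac f (fun _ => (1 : ℂ)) hfc.measurable
      (fun _ _ _ => rfl) ?_
    simpa only [mul_one] using ((hfc.integrable_of_hasCompactSupport hfK).integrableOn : IntegrableOn f GT ν)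
  have hmeas : AEStronglyMeasurable (fun t : ↥T => (D t : ℝ) • (K t * O t)) (tT.restrict Treg) := by
    have h1 : AEStronglyMeasurable (fun t : ↥T => K t • ((D t : ℝ) • ((fun _ => (1 : ℂ)) (t : Gqs L v) * O t))) (tT.restrict Treg) :=
      hK.aestronglyMeasurable.smul hA1.aestronglyMeasurable
    refine h1.congr (Eventually.of_forall fun t => ?_)
    show K t • ((D t : ℝ) • ((1 : ℂ) * O t)) = (D t : ℝ) • (K t * O t)
    rw [one_mul, smul_comm, smul_eq_mul]
  have hbound : ∀ t ∈ Treg, ‖(D t : ℝ) • (K t * O t)‖ ≤ |B| * ‖(D t : ℝ) • (α (t : Gqs L v) * classOrbitalIntegral mQv φ (ConjClasses.mk (t : Gqs L v)))‖ := by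
    intro t ht
    by_cases hmeet : ∃ x : Gqs L v, x * (t : Gqs L v) * x⁻¹ ∈ tsupport f
    · have hKt : ‖K t‖ ≤ |B| * (dg (t : Gqs L v))⁻¹ :=
        (hKB t ht hmeet).trans (mul_le_mul_of_nonneg_right (le_abs_self B) (inv_nonneg.2 (hdg0 _)))
      have hO : ‖O t‖ ≤ ‖classOrbitalIntegral mQv φ (ConjClasses.mk (t : Gqs L v))‖ := by
        simp only [hOdef, classOrbitalIntegral_eq, hφ]
        exact norm_orbitalIntegral_le_norm_orbitalIntegral_norm _ _ f
      rw [norm_smul, norm_smul, norm_mul, norm_mul, hαn, Real.norm_eq_abs, abs_of_nonneg (NNReal.coe_nonneg _)]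
      calc (D t : ℝ) * (‖K t‖ * ‖O t‖)
          ≤ (D t : ℝ) * ((|B| * (dg (t : Gqs L v))⁻¹) * ‖classOrbitalIntegral mQv φ (ConjClasses.mk (t : Gqs L v))‖) :=
            mul_le_mul_of_nonneg_left (mul_le_mul hKt hO (norm_nonneg _) (mul_nonneg (abs_nonneg _) (inv_nonneg.2 (hdg0 _)))) (NNReal.coe_nonneg _)
        _ = |B| * ((D t : ℝ) * ((dg (t : Gqs L v))⁻¹ * ‖classOrbitalIntegral mQv φ (ConjClasses.mk (t : Gqs L v))‖)) := by ring
    · push Not at hmeet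
      have hO0 : O t = 0 := classOrbitalIntegral_mk_eq_zero_of_forall_notMem_tsupport mQv (t : Gqs L v) hmeet
      rw [hO0, mul_zero, smul_zero, norm_zero]
      exact mul_nonneg (abs_nonneg _) (norm_nonneg _)
  exact Integrable.mono' ((hA.norm).const_mul |B|) hmeas ((ae_restrict_iff' hTregm).2 (Eventually.of_forall hbound))

end OrbitSum
end Summit.HodgeConjecture.HodgeConjecture.Cruxes.H413.F0P3cStCharTSUpTrSlotIntegrable
end
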